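import Summits.BirchSwinnertonDyer.BirchSwinnertonDyer.Theorems.SelmerRankSelmerRankLBOfEvenGap
import Summits.BirchSwinnertonDyer.BirchSwinnertonDyer.Theorems.SelmerRankSelmerRankLBOfHeegnerGap
import HarnessLib

/-!
# Crux `SelmerRankLB` (stmt-BirchSwinnertonDyer-0131) — the two open cores of its two lines carry the same information: even-gap vanishing V2b (Kato side) ⟺ Heegner-gap vanishing HV (Heegner side), modulo named literature facts

Continuation lead of line `heegner_order` (`prover-line-stmt-BirchSwinnertonDyer-0131-c1-0`, cycle 1, 2026-08-17).

The crux has two registered lines, each driven to a single open stub that is kernel-checked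
EQUIVALENT to the crux modulo named facts:

* line `kurihara_order` (Kato–Kolyvagin / Kurihara numbers): open core **V2b** `stub_delta_evenGap`
  — for `2 ≤ ν(n) < r_an`, `ν(n) ≡ r_an (mod 2)`, the Kurihara number `δ_n^{(k)}` vanishes; certificate
  `Theorems/SelmerRankSelmerRankLBOfEvenGap.lean` (`selmerRankLB_of_evenGap_of_facts`,
  `evenGap_of_selmerRankLB_of_facts`), facts {modularity, Kim 2022 Thm. 1.9 (1) both directions F1/F3,
  period unit F2, corank-1 `p`-converse F4, `p`-parity};
* line `heegner_order` (Heegner–Kolyvagin classes): open core **HV** `stub_heegner_gap` — for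
  `1 ≤ ν(n) ≤ r_an − 3`, `ν(n) ≡ r_an + 1 (mod 2)`, the derived class `c_M(n)` vanishes; certificate
  `Theorems/SelmerRankSelmerRankLBOfHeegnerGap.lean` (`selmerRankLB_of_heegnerGap_of_facts`,
  `heegnerGap_of_selmerRankLB_of_facts`), facts {modularity, Hoffstein–Luo, Bump–Friedberg–Hoffstein,
  GZK, `analyticRankEK_eq_add`, GZ non-torsion criterion, conductor-1 reciprocity, BCGS 2026 Thm. 1,
  Kolyvagin 1991 Thm. 4}.

Composing the four certificates THROUGH THE CRUX gives the dictionary predicted by the line card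
(`Cruxes/SelmerRankLB/Lines/heegner-order.md`, after C.-H. Kim 2022b Thm. 2.3
`ord κ^{Heeg} + 1 = max{ord δ̃(E), ord δ̃(E^K)}`): modulo the union of the two fact sets, **V2b ⟺ HV**
(`evenGap_of_heegnerGap_of_facts`, `heegnerGap_of_evenGap_of_facts`). The open content of the crux is
ONE statement in two receptacles — the vanishing of depth-`(ν+1)` Kurihara numbers over `ℚ` and of
depth-`ν` Heegner derivative classes over `K` — and a lead stuck on one may switch to the other without
loss. (The dictionary here goes through the crux, not through Kim's direct comparison of the two
Kolyvagin systems, which the tree does not have.) Both theorems are CONDITIONAL (`--supports`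
helpers); neither closes the item; both open statements are written out literally (registered stubs,
no `def` minted).
-/

set_option linter.dupNamespace false

noncomputable section

namespace Summit.BirchSwinnertonDyer.BirchSwinnertonDyer.Theorems

open scoped MatrixGroups ModularForm Classical
open CongruenceSubgroup Literature.NumberTheory.EllipticCurves
  Literature.NumberTheory.EllipticCurves.ModularForms WeierstrassCurve
open Summit.BirchSwinnertonDyer.BirchSwinnertonDyer.Theses

/-- **HV ⇒ V2b modulo named facts.** From the Heegner-side facts {modularity, Hoffstein–Luo,
Bump–Friedberg–Hoffstein, GZK, `analyticRankEK_eq_add`, Gross–Zagier non-torsion criterion,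
conductor-`1` reciprocity, BCGS 2026 Thm. 1, Kolyvagin 1991 Thm. 4} and the Heegner-gap vanishing HV
(the open stub of line `heegner_order`, written out literally) one gets the crux
(`selmerRankLB_of_heegnerGap_of_facts`), and from the crux with Kim 2022 Thm. 1.9 (1) (upper
direction, F3) and the period unit (F2) the even-gap vanishing V2b of line `kurihara_order`
(`evenGap_of_selmerRankLB_of_facts`). CONDITIONAL; credits nothing to the item.
[cite: Kolyvagin1991MathAnn, §2 Thm. 4] [cite: Kim2022StructureSelmer, Thm. 1.9 (1) (p. 7)] -/
theorem evenGap_of_heegnerGap_of_facts :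
    exists_isNewformOf → HoffsteinLuo1997_exists_twist_L_one_ne_zero →
    bumpFriedbergHoffstein_exists_heegnerField_split_twist_simpleZero →
    rank_eq_analyticRank_of_analyticRank_le_one →
    (∀ (W : WeierstrassCurve ℚ) (K : Type) [Field K] [NumberField K], analyticRankEK_eq_add W K) →
    (∀ (W : WeierstrassCurve ℚ) (N : ℕ) [NeZero N] (K : Type) [Field K] [NumberField K],
        analyticRankEK_eq_one_iff_heegner_nonTorsion W N K) →
    (∀ (N : ℕ) [NeZero N] (W : WeierstrassCurve ℚ) (K : Type) [Field K] [NumberField K],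
        heegnerPointOfConductor_one_galoisConj N W K) →
    BurungaleEtAl2026_exists_kolyvaginClass_ne_zero →
    Kolyvagin1991_selmerCorank_of_kolyvaginClass_ne_zero →
    Literature.NumberTheory.EllipticCurves.Kim2022_selmerCorank_le_of_kuriharaNumber_ne_zero →
    realPeriodRat_eq_unit_mul_plusPeriod →
    (∀ (W : WeierstrassCurve ℚ) [W.IsElliptic] [W.IsGloballyMinimal] (p : ℕ) [hp : Fact p.Prime],
      5 ≤ p → W.HasGoodReductionAtPrime p → ¬ (p : ℤ) ∣ W.frobeniusTrace p →
      W.HasSurjectiveModNGaloisRep p →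
      ∀ (K : Type) [Field K] [NumberField K], IsImaginaryQuadratic K →
        NumberField.discr K ≠ -3 → NumberField.discr K ≠ -4 → ¬ ((p : ℤ) ∣ NumberField.discr K) →
        ∀ [NeZero (W.conductorNorm ℤ)], SatisfiesHeegnerHypothesis (W.conductorNorm ℤ) K →
        Odd (NumberField.discr K) → SatisfiesHeegnerHypothesis p K →
        (W.quadraticTwist (NumberField.discr K : ℚ)).analyticRank ≤ 1 →
        Odd (W.analyticRank + (W.quadraticTwist (NumberField.discr K : ℚ)).analyticRank) →
        ∀ (Dt : ModularParametrizationData W (W.conductorNorm ℤ)) (β : ℤ) (ι : K →+* ℂ) (n : ℕ)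
          (d : KolyvaginHeegnerData Dt β ι n) (M : ℕ),
          Squarefree n → (∀ ℓ ∈ n.primeFactors, Zhang2014.IsKolyvaginPrime (W.conductorNorm ℤ) W K p ℓ) →
          1 ≤ M → (M : ℕ∞) ≤ Zhang2014.levelIndex W p n →
          1 ≤ n.primeFactors.card → n.primeFactors.card + 3 ≤ W.analyticRank →
          Even (n.primeFactors.card + W.analyticRank + 1) →
          d.kolyvaginClass hp.out M = 0) →
    ∀ (W : WeierstrassCurve ℚ) [W.IsElliptic] [W.IsGloballyMinimal] (p : ℕ) [Fact p.Prime],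
      5 ≤ p → W.HasGoodReductionAtPrime p → ¬ (p : ℤ) ∣ W.frobeniusTrace p →
      W.HasSurjectiveModNGaloisRep p →
      ∀ (_ : NeZero (W.conductorNorm ℤ)) (f : CuspForm (Gamma0 (W.conductorNorm ℤ)) 2),
        IsNewformOf W f →
        ∀ (k n : ℕ) [NeZero n], 1 ≤ k → Kato.IsKolyvaginProduct W p k n → 2 ≤ n.primeFactors.card →
          Even (n.primeFactors.card + W.analyticRank) →
          n.primeFactors.card < W.analyticRank →
          ∀ ψ : (ℓ : ℕ) → (ZMod ℓ)ˣ →* Multiplicative (ZMod (p ^ k)),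
            (∀ ℓ ∈ n.primeFactors, Function.Surjective (ψ ℓ)) →
            kuriharaNumber f (p ^ k) n ψ = 0 := by
  intro hmod hHL hBFH hGZK hadd hGZ hrec hA hB hF3 hF2 hHV
  exact evenGap_of_selmerRankLB_of_facts hF3 hF2
    (selmerRankLB_of_heegnerGap_of_facts hmod hHL hBFH hGZK hadd hGZ hrec hA hB hHV)

/-- **V2b ⇒ HV modulo named facts.** From the Kato-side facts {modularity, Kim 2022 Thm. 1.9 (1) in
both directions (F1, F3), the period unit (F2), the corank-1 `p`-converse (F4), `p`-parity} and the
even-gap vanishing V2b (the open stub of line `kurihara_order`, written out literally) one gets the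
crux (`selmerRankLB_of_evenGap_of_facts`), and from the crux with Kolyvagin 1991 Thm. 4 alone the
Heegner-gap vanishing HV of line `heegner_order` (`heegnerGap_of_selmerRankLB_of_facts`). Together with
`evenGap_of_heegnerGap_of_facts`: modulo the union of the two fact sets, V2b ⟺ HV. CONDITIONAL;
credits nothing to the item.
[cite: Kim2022StructureSelmer, Thm. 1.9 (1) and Cor. 1.6 (pp. 6–7)] [cite: Kolyvagin1991MathAnn, §2 Thm. 4] -/
theorem heegnerGap_of_evenGap_of_facts :
    exists_isNewformOf → Kim2022_exists_kuriharaNumber_ne_zero_of_selmerCorank →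
    realPeriodRat_eq_unit_mul_plusPeriod →
    Literature.NumberTheory.EllipticCurves.Kim2022_selmerCorank_le_of_kuriharaNumber_ne_zero →
    Literature.NumberTheory.EllipticCurves.yanZhu_analyticRank_eq_one_of_selmerCorank_eq_one →
    (∀ (W : WeierstrassCurve ℚ) [W.IsElliptic] (p : ℕ) [Fact p.Prime],
      Literature.NumberTheory.EllipticCurves.selmerCorank_mod_two_eq W p) →
    Kolyvagin1991_selmerCorank_of_kolyvaginClass_ne_zero →
    (∀ (W : WeierstrassCurve ℚ) [W.IsElliptic] [W.IsGloballyMinimal] (p : ℕ) [Fact p.Prime],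
      5 ≤ p → W.HasGoodReductionAtPrime p → ¬ (p : ℤ) ∣ W.frobeniusTrace p →
      W.HasSurjectiveModNGaloisRep p →
      ∀ (_ : NeZero (W.conductorNorm ℤ)) (f : CuspForm (Gamma0 (W.conductorNorm ℤ)) 2),
        IsNewformOf W f →
        ∀ (k n : ℕ) [NeZero n], 1 ≤ k → Kato.IsKolyvaginProduct W p k n → 2 ≤ n.primeFactors.card →
          Even (n.primeFactors.card + W.analyticRank) →
          n.primeFactors.card < W.analyticRank →
          ∀ ψ : (ℓ : ℕ) → (ZMod ℓ)ˣ →* Multiplicative (ZMod (p ^ k)),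
            (∀ ℓ ∈ n.primeFactors, Function.Surjective (ψ ℓ)) →
            kuriharaNumber f (p ^ k) n ψ = 0) →
    ∀ (W : WeierstrassCurve ℚ) [W.IsElliptic] [W.IsGloballyMinimal] (p : ℕ) [hp : Fact p.Prime],
      5 ≤ p → W.HasGoodReductionAtPrime p → ¬ (p : ℤ) ∣ W.frobeniusTrace p →
      W.HasSurjectiveModNGaloisRep p →
      ∀ (K : Type) [Field K] [NumberField K], IsImaginaryQuadratic K →
        NumberField.discr K ≠ -3 → NumberField.discr K ≠ -4 → ¬ ((p : ℤ) ∣ NumberField.discr K) →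
        ∀ [NeZero (W.conductorNorm ℤ)], SatisfiesHeegnerHypothesis (W.conductorNorm ℤ) K →
        Odd (NumberField.discr K) → SatisfiesHeegnerHypothesis p K →
        (W.quadraticTwist (NumberField.discr K : ℚ)).analyticRank ≤ 1 →
        Odd (W.analyticRank + (W.quadraticTwist (NumberField.discr K : ℚ)).analyticRank) →
        ∀ (Dt : ModularParametrizationData W (W.conductorNorm ℤ)) (β : ℤ) (ι : K →+* ℂ) (n : ℕ)
          (d : KolyvaginHeegnerData Dt β ι n) (M : ℕ),
          Squarefree n → (∀ ℓ ∈ n.primeFactors, Zhang2014.IsKolyvaginPrime (W.conductorNorm ℤ) W K p ℓ) →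
          1 ≤ M → (M : ℕ∞) ≤ Zhang2014.levelIndex W p n →
          1 ≤ n.primeFactors.card → n.primeFactors.card + 3 ≤ W.analyticRank →
          Even (n.primeFactors.card + W.analyticRank + 1) →
          d.kolyvaginClass hp.out M = 0 := by
  intro hmod hF1 hF2 hF3 hF4 hpar hB hV2b
  exact heegnerGap_of_selmerRankLB_of_facts hB
    (selmerRankLB_of_evenGap_of_facts hmod hF1 hF2 hF3 hF4 hpar hV2b)

end Summit.BirchSwinnertonDyer.BirchSwinnertonDyer.Theorems

end
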